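import Literature.NumberTheory.EllipticCurves.ModFiveCongruenceHesseFamily
import Literature.NumberTheory.EllipticCurves.Fisher2012.HesseFamilyFiveCongruence
import Literature.NumberTheory.Automorphic.CDTTheorem712
import Mathlib.LinearAlgebra.Matrix.SpecialLinearGroup
import HarnessLib

/-!
# stub-ideation k2 · GENERATION 15 — `stub_switch` (crux `FreyModularity`, stmt-ABC-11340)
# Typed helper statements (statements only; `sorry` = the helper is a work unit, not a claim).

§1 the module-boundary theorems of the LANDING (T1, weaken-and-bootstrap at landing level);
§2 the one de-weakening lemma (T2, generic-point reformulation: F1 VERBATIM, road unedited);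
§3 the symmetry-forced additivity lemma (T3, insurance engine for the level structure).
-/

set_option linter.style.longLine false
set_option linter.dupNamespace false

namespace Summit.ABC.ABC.Cruxes.FreyModularity.StubSwitchK2g15

open Literature.NumberTheory.EllipticCurves Literature.NumberTheory.EllipticCurves.HesseFamilyFive
open Literature.NumberTheory.Automorphic Literature.NumberTheory.Automorphic.BCDT
open Literature.NumberTheory.GaloisRepresentations

noncomputable section

/-! ## §1 Landing interface: one theorem per module boundary (each = ONE proposal / one prover cycle) -/

/-- **L4** `…/EllipticCurves/ModFiveCongruenceHesseFamilyProofs.lean ▸ thm132_geomTorsionFive_of_hesseFamily_holds`: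
F1 VERBATIM (Fisher 2012 Thm 13.2 (i), n = 5) — type = the registered fact BY NAME, so accept fires `fact-discharged`.
Proof = k2-g12 `F1ne_of_frame` with `kC6_pencil_eq … hc6'` replaced by §2 `lemma84_C6'` (3 sites, binder `c₆ ≠ 0` deleted),
fed by `table_frameCertified` (L3), `lemma84_C4`, `lemma84_D`, `exists_torsorPoint`, `hesse_syzygy₂` (L1). -/
theorem F1_holds : thm132_geomTorsionFive_of_hesseFamily := by
  sorry

/-- **L4′** twin fact, same file: `Fisher2012.thm132_fiveCongruent_hessePencil_holds` — from `F1_holds` by the PROVED bridge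
k2-g14 `fiveCongruent_hessePencil_of_hesseFamily` (`2g14_Bridge.lean`, rc 0, 5 s). -/
theorem F1'_holds : Fisher2012.thm132_fiveCongruent_hessePencil := by
  sorry

/-- **L5** `…/Automorphic/CDTThreeFiveSwitchOfHesseProofs.lean ▸ CDT_three_five_switch_of_thm132`: the road
(k3-g11 `STUB_IDEAS_stub_switch_3g11_Road.lean`, rc 0 / 0 sorry / 339 s today; 5 lint warnings to fix first). -/
theorem road : thm132_geomTorsionFive_of_hesseFamily → CDT_three_five_switch := by
  sorry

/-- **L6** `…/Automorphic/CDTThreeFiveSwitchHolds.lean ▸ CDT_three_five_switch_holds` (fires `fact-discharged`). -/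
theorem CDT_three_five_switch_holds : CDT_three_five_switch :=
  road F1_holds

/-- **L7⁻** (Theorems, prover, `--supports stmt-ABC-11340`, lands as soon as L5 is in): the stub CONDITIONAL on F1 by name. -/
theorem stub_switch_of_thm132 (hF : thm132_geomTorsionFive_of_hesseFamily) :
    ∀ (W : WeierstrassCurve ℚ) [W.IsElliptic], ¬ 27 ∣ W.conductorNorm ℤ →
      (∀ ρ₃ : ModPGaloisRep ℚ (ZMod 3) 2, W.IsTorsionGaloisRep 3 ρ₃ →
        ¬ ρ₃.IsAbsIrreducibleOverSqrt (-3)) →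
      ∀ (ρ : ModPGaloisRep ℚ (ZMod 5) 2), W.IsTorsionGaloisRep 5 ρ → ρ.IsAbsIrreducibleOverSqrt 5 →
      ∃ (W' : WeierstrassCurve ℚ) (_ : W'.IsElliptic), W'.IsTorsionGaloisRep 5 ρ ∧
        ∃ ρ₃' : ModPGaloisRep ℚ (ZMod 3) 2, W'.IsTorsionGaloisRep 3 ρ₃' ∧
          ρ₃'.IsAbsIrreducibleOverSqrt (-3) :=
  road hF

/-- **L7** `Summits/ABC/ABC/Theorems/DefiniteXiFreyModularityStubSwitch.lean ▸ stub_switch`: the registered stub VERBATIM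
(`Sketch.stub_switch ↔ CDT_three_five_switch` is `Iff.rfl`), one term. -/
theorem stub_switch :
    ∀ (W : WeierstrassCurve ℚ) [W.IsElliptic], ¬ 27 ∣ W.conductorNorm ℤ →
      (∀ ρ₃ : ModPGaloisRep ℚ (ZMod 3) 2, W.IsTorsionGaloisRep 3 ρ₃ →
        ¬ ρ₃.IsAbsIrreducibleOverSqrt (-3)) →
      ∀ (ρ : ModPGaloisRep ℚ (ZMod 5) 2), W.IsTorsionGaloisRep 5 ρ → ρ.IsAbsIrreducibleOverSqrt 5 →
      ∃ (W' : WeierstrassCurve ℚ) (_ : W'.IsElliptic), W'.IsTorsionGaloisRep 5 ρ ∧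
        ∃ ρ₃' : ModPGaloisRep ℚ (ZMod 3) 2, W'.IsTorsionGaloisRep 3 ρ₃' ∧
          ρ₃'.IsAbsIrreducibleOverSqrt (-3) :=
  CDT_three_five_switch_holds

/-! ## §2 The de-weakening lemma (T2): Fisher's Lemma 8.4 for `𝔠₆`, hypothesis-free -/

section Klein
variable {R : Type*} [CommRing R]

/-- Klein's `D` (degree 12). [folklore] -/
def kD (a b : R) : R := a ^ 11 * b - 11 * a ^ 6 * b ^ 6 - a * b ^ 11
/-- `∂D/∂a`. [folklore] -/
def kDa (a b : R) : R := 11 * a ^ 10 * b - 66 * a ^ 5 * b ^ 6 - b ^ 11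
/-- `∂D/∂b`. [folklore] -/
def kDb (a b : R) : R := a ^ 11 - 66 * a ^ 6 * b ^ 5 - 11 * a * b ^ 10
/-- Klein's `c₄` (degree 20). [folklore] -/
def kC4 (a b : R) : R :=
  a ^ 20 + 228 * a ^ 15 * b ^ 5 + 494 * a ^ 10 * b ^ 10 - 228 * a ^ 5 * b ^ 15 + b ^ 20
/-- Klein's `c₆` (degree 30). [folklore] -/
def kC6 (a b : R) : R :=
  -a ^ 30 + 522 * a ^ 25 * b ^ 5 + 10005 * a ^ 20 * b ^ 10 + 10005 * a ^ 10 * b ^ 20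
    - 522 * a ^ 5 * b ^ 25 - b ^ 30
/-- Fisher's covariant pencil `M_v(λ, μ)`, first coordinate. [cite: Fisher2012Hessian, Lemma 8.4] -/
def Mv1 (a b l m : R) : R := l * a - m * kDb a b
/-- second coordinate. [cite: Fisher2012Hessian, Lemma 8.4] -/
def Mv2 (a b l m : R) : R := l * b + m * kDa a b

end Klein

/-- **H2 · `lemma84_C6'`** (PROVED k2-g13 `…2g13_GenericSign.lean`, rc 0 / 0 sorry / 0 warnings / 252 s): for EVERY field of
characteristic 0 and ALL `a b l m` (no `kD ≠ 0`, no `c₆ ≠ 0`): `𝔠₆(c₄^{Kl}, c₆^{Kl}; λ, μ) = c₆^{Kl}(M_v(λ, μ))`.  It replaces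
k2-g12 `kC6_pencil_eq (hc6' : kC6 a b ≠ 0)` at its three call sites, so `F1ne_of_frame` becomes `F1_of_frame : … → F1` VERBATIM. -/
theorem lemma84_C6' {F : Type*} [Field F] [CharZero F] (a b l m : F) :
    C6 (kC4 a b) (kC6 a b) l m = kC6 (Mv1 a b l m) (Mv2 a b l m) := by
  sorry

/-! ## §3 Insurance engine (T3): additivity of the level structure FORCED by `SL₂(𝔽₅)`-equivariance -/

/-- the two standard generators of `SL₂(𝔽₅)` (elementary transvections). [folklore] -/
def genS : Matrix (Fin 2) (Fin 2) (ZMod 5) := !![1, 1; 0, 1]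
/-- [folklore] -/
def genT : Matrix (Fin 2) (Fin 2) (ZMod 5) := !![1, 0; 1, 1]

/-- **H6 · symmetry-forced additivity (abstract, Mathlib-only, M-sized).**  A bijection `β : 𝔽₅² → V` onto a group of
order 25 and exponent 5 with `β 0 = 0` that intertwines the two elementary transvections with ADDITIVE automorphisms of `V`
is additive.  Proof (½ page): `Θ(g) := β ∘ g ∘ β⁻¹` is additive for every word `g` in `genS, genT`, i.e. on all of
`SL₂(𝔽₅)` (H7); for `x ≠ 0` the transvection `u_x` fixing `x` gives `Θ(u_x)` of order 5, hence a transvection of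
`V ≅ 𝔽₅²` with fixed line `⟨β x⟩ ∋ β(kx)` (lines ↦ lines); for independent `x, y` and `τ : x ↦ x, y ↦ x + y`,
`β(x+y) = β y + c·β x` and symmetrically `= β x + c'·β y` force `c = c' = 1`; iterate `τ` for `β(y + kx) = β y + k β x`,
whence `β(kx) = k β x` and full additivity.  (No Galois "big image" and no FTPG — both FAIL in dimension 2.) [folklore] -/
theorem additive_of_sl2_equivariant {V : Type*} [AddCommGroup V] (hV : Nat.card V = 25)
    (h5 : ∀ v : V, 5 • v = 0) (β : (Fin 2 → ZMod 5) → V) (hβ : Function.Bijective β) (h0 : β 0 = 0)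
    (θS θT : V ≃+ V) (hS : ∀ x, β (genS.mulVec x) = θS (β x)) (hT : ∀ x, β (genT.mulVec x) = θT (β x)) :
    ∀ x y, β (x + y) = β x + β y := by
  sorry

/-- **H7 · generation** (finite; explicit word table, `decide` per element). [folklore] -/
theorem sl2_zmod5_generated :
    Subgroup.closure ({⟨genS, by decide⟩, ⟨genT, by decide⟩} : Set (Matrix.SpecialLinearGroup (Fin 2) (ZMod 5))) = ⊤ := by
  sorry

/-- **H8 · shape of ONE equivariance certificate** (48 in all = 2 generators × 24 nonzero labels; pure substitution identities,
NO group law, NO non-degeneracy side conditions): for a section law `X` natural in the ring, a generator `γ̃ = √5·γ ∈ M₂(ℤ[ζ])`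
(`γ ∈ 2I ⊂ SL₂(ℚ(ζ₅))`, Klein's forms are `2I`-INVARIANT because `2I ≅ SL₂(𝔽₅)` is perfect) and its label permutation `π`,
`X_x(z; γ̃(a,b)) = 5^{d/2} · X_{π x}(z; a, b)  (mod Φ₅(z))`, `d` = the `(a,b)`-degree of `X_x`.  Stated here for ONE abstract
pair of laws to fix the Lean shape only. [folklore] -/
theorem equivariance_certificate_shape
    (X Xπ : ∀ (R : Type) [CommRing R], R → R → R → R) (m₁₁ m₁₂ m₂₁ m₂₂ : ∀ (R : Type) [CommRing R], R → R) (d : ℕ)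
    (hcert : ∀ (R : Type) [CommRing R] (z a b : R), z ^ 4 + z ^ 3 + z ^ 2 + z + 1 = 0 →
      X R z (m₁₁ R z * a + m₁₂ R z * b) (m₂₁ R z * a + m₂₂ R z * b) = 5 ^ d * Xπ R z a b)
    (F : Type) [Field F] [CharZero F] (z a b : F) (hz : z ^ 4 + z ^ 3 + z ^ 2 + z + 1 = 0) :
    X F z (m₁₁ F z * a + m₁₂ F z * b) (m₂₁ F z * a + m₂₂ F z * b) = 5 ^ d * Xπ F z a b :=
  hcert F z a b hz

end

end Summit.ABC.ABC.Cruxes.FreyModularity.StubSwitchK2g15
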